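import Literature.NumberTheory.LFunctions.AndersonStarkLemma1
import Literature.NumberTheory.LFunctions.LiouvilleOneSided
import Literature.NumberTheory.LFunctions.AndersonStarkLiouville
import HarnessLib

/-!
# Anderson–Stark's Theorem 1 for `L(x)`: the right vertical line

Topic `Literature/NumberTheory/LFunctions`. Everything in this file is PROVED.

In the proof of Anderson–Stark's Theorem 1 (*Oscillation theorems*, LNM 899, §4) applied to
`g(x) = L(x) − 1` (`x > 1`), `g = 0` (`x < 1`), with
`G(s) = ∫_0^∞ g(x) x^{-s} dx/x = (1/s)(ζ(2s)/ζ(s) − 1)` ("Needless to say …", §4 after (19)), the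
right vertical line `Re s = σ₂ > 1` contributes
`(1/2πi) ∫_{(σ₂)} G(s) e^{ε(s−½)²} x₀^{s−½} ds → x₀^{-1/2} g(x₀) = (L(x₀) − 1)/√x₀` as `ε → 0⁺`
(Lemma 1, at a continuity point `x₀` of `g`, i.e. `x₀ > 1` not an integer). This file proves that
statement with `σ₂ = 3/2`, in the parametrisation `s = 3/2 + it`:

* `laplace_liouvilleShift_eq` — the Laplace transform on `Re s > 1`:
  `∫ f(u) e^{−su} du = ζ(2s)/(sζ(s)) − 1/s` for `f(u) = L(e^u) − 𝟙_{u>0}` (the tree's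
  `laplace_normalizedLiouville_eq_mellin`, `mellin_liouvilleSum`, and `∫_0^∞ e^{−su} du = 1/s`);
* `andersonStark_rightLine_tendsto` — the limit above (the tree's `AndersonStark1981_lemma1`
  with `σ = 3/2`, `a = 1`, `u₀ = log x₀`);
* `andersonStark_rightLine_integrable` — integrability of the integrand on the line for `ε > 0`.

The integrand is written as `Ψ_{ε,x₀}(z) = (ζ(2z)/(zζ(z)) − 1/z) · e^{ε(z−½)²} e^{(z−½) log x₀}`
evaluated at `z = 3/2 + it`, the form used for the contour in the sibling files.

## References

* [AndersonStark1981] R. J. Anderson, H. M. Stark, *Oscillation theorems*, LNM 899 (1981), §4,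
  Lemma 1, Theorem 1 (proof) and the `L(x)` paragraph after (19).
-/

noncomputable section

open Complex Filter MeasureTheory Set
open scoped Real Topology

namespace Literature.NumberTheory.LFunctions

/-! ## The Laplace transform on `Re s > 1` -/

/-- `∫ L(e^u) e^{−su} du = ζ(2s)/(sζ(s))` for `Re s > 1` (the tree's Laplace–Mellin identity for
`A(u) = L(e^u)e^{−u/2}` and `∫_1^∞ L(x)x^{−s−1} dx = ζ(2s)/(sζ(s))`).
[cite: AndersonStark1981, §4 (after (19))] -/
theorem laplace_liouvilleSum_exp {s : ℂ} (hs : 1 < s.re) :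
    ∫ u : ℝ, (liouvilleSum (Real.exp u) : ℂ) * cexp (-(s * u)) =
      riemannZeta (2 * s) / (s * riemannZeta s) := by
  rw [← mellin_liouvilleSum hs, ← laplace_normalizedLiouville_eq_mellin s]
  refine integral_congr_ae (ae_of_all _ fun u ↦ ?_)
  unfold normalizedLiouville
  push_cast
  rw [mul_assoc, ← Complex.exp_add]
  congr 2
  ring

/-- The shifted function `f(u) = L(e^u) − 𝟙_{u>0}` of the right line (`= g(e^u)`,
`g = L − 1` on `x > 1`, `0` on `x < 1`, up to `u = 0`), damped by `e^{−σu}`, is integrable for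
`σ > 1` (`|L(e^u)| ≤ e^u`, and `L(e^u) = 0` for `u < 0`). [folklore] -/
theorem integrable_liouvilleShift_damped {σ : ℝ} (hσ : 1 < σ) :
    Integrable fun u : ℝ ↦ ((liouvilleSum (Real.exp u) : ℂ) - if 0 < u then 1 else 0) *
      (Real.exp (-(σ * u)) : ℂ) := by
  -- dominated by `2 e^{(1-σ)u}` on `u ≥ 0`, `0` on `u < 0`
  have hdom : Integrable fun u : ℝ ↦ (Ici (0 : ℝ)).indicator (fun u ↦ 2 * Real.exp ((1 - σ) * u)) u := by
    rw [integrable_indicator_iff measurableSet_Ici]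
    have h : IntegrableOn (fun u : ℝ ↦ Real.exp (-(σ - 1) * u)) (Ioi 0) :=
      exp_neg_integrableOn_Ioi 0 (by linarith)
    have h2 : IntegrableOn (fun u : ℝ ↦ 2 * Real.exp (-(σ - 1) * u)) (Ioi 0) := h.const_mul 2
    have h' : IntegrableOn (fun u : ℝ ↦ 2 * Real.exp ((1 - σ) * u)) (Ioi 0) := by
      refine h2.congr_fun (fun u _ ↦ ?_) measurableSet_Ioi
      simp only [neg_sub]
    exact Iff.mpr integrableOn_Ici_iff_integrableOn_Ioi h'
  refine hdom.mono' ?_ (Eventually.of_forall fun u ↦ ?_)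
  · refine AEStronglyMeasurable.mul (AEStronglyMeasurable.sub ?_ ?_) (by fun_prop)
    · exact (Complex.measurable_ofReal.comp ((measurable_liouvilleSum).comp
        Real.measurable_exp)).aestronglyMeasurable
    · refine Measurable.aestronglyMeasurable ?_
      exact Measurable.ite measurableSet_Ioi measurable_const measurable_const
  · rcases lt_or_ge u 0 with hu | hu
    · have h0 : liouvilleSum (Real.exp u) = 0 := liouvilleSum_of_lt_one (Real.exp_lt_one_iff.2 hu)
      rw [Set.indicator_of_notMem (by simpa using hu)]
      simp [h0, not_lt.2 hu.le]
    · rw [Set.indicator_of_mem (mem_Ici.2 hu), norm_mul, Complex.norm_real,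
        Real.norm_of_nonneg (Real.exp_pos _).le]
      have hL : ‖(liouvilleSum (Real.exp u) : ℂ) - if 0 < u then 1 else 0‖ ≤ Real.exp u + 1 := by
        refine (norm_sub_le _ _).trans (add_le_add ?_ ?_)
        · rw [Complex.norm_intCast]
          have := abs_liouvilleSum_le (Real.exp_pos u).le
          exact_mod_cast this
        · split_ifs <;> simp
      have h1 : 1 ≤ Real.exp u := Real.one_le_exp hu
      calc ‖(liouvilleSum (Real.exp u) : ℂ) - if 0 < u then 1 else 0‖ * Real.exp (-(σ * u))
          ≤ (Real.exp u + 1) * Real.exp (-(σ * u)) :=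
            mul_le_mul_of_nonneg_right hL (Real.exp_pos _).le
        _ ≤ (2 * Real.exp u) * Real.exp (-(σ * u)) :=
            mul_le_mul_of_nonneg_right (by linarith) (Real.exp_pos _).le
        _ = 2 * Real.exp ((1 - σ) * u) := by
            rw [mul_assoc, ← Real.exp_add]; congr 2; ring

/-- **The Laplace transform of the right line**: for `Re s > 1`,
`∫ (L(e^u) − 𝟙_{u>0}) e^{−su} du = ζ(2s)/(sζ(s)) − 1/s` — Anderson–Stark's
`G(s) = (1/s)(ζ(2s)/ζ(s) − 1)`, the Mellin transform of `g = L − 1` (`x > 1`).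
[cite: AndersonStark1981, §4 (after (19))] -/
theorem laplace_liouvilleShift_eq {s : ℂ} (hs : 1 < s.re) :
    ∫ u : ℝ, ((liouvilleSum (Real.exp u) : ℂ) - if 0 < u then 1 else 0) * cexp (-(s * u)) =
      riemannZeta (2 * s) / (s * riemannZeta s) - 1 / s := by
  have hs0 : 0 < s.re := by linarith
  -- integrability of the two pieces
  have hσ : Integrable fun u : ℝ ↦ ((liouvilleSum (Real.exp u) : ℂ) - if 0 < u then 1 else 0) *
      cexp (-(s * u)) := by
    have h := integrable_liouvilleShift_damped hs
    refine (h.norm.mono' ?_ (Eventually.of_forall fun u ↦ ?_))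
    · refine AEStronglyMeasurable.mul (AEStronglyMeasurable.sub ?_ ?_) (by fun_prop)
      · exact (Complex.measurable_ofReal.comp ((measurable_liouvilleSum).comp
          Real.measurable_exp)).aestronglyMeasurable
      · exact (Measurable.ite measurableSet_Ioi measurable_const measurable_const).aestronglyMeasurable
    · rw [norm_mul, norm_mul, Complex.norm_exp, Complex.norm_real, Real.norm_of_nonneg
        (Real.exp_pos _).le]
      have : (-(s * (u : ℂ))).re = -(s.re * u) := by simp
      rw [this]
  have hind : Integrable fun u : ℝ ↦ (if 0 < u then (1 : ℂ) else 0) * cexp (-(s * u)) := by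
    have h : IntegrableOn (fun u : ℝ ↦ cexp (-s * u)) (Ioi 0) :=
      integrableOn_exp_mul_complex_Ioi (by simpa using hs0) 0
    have h' : Integrable fun u : ℝ ↦ (Ioi (0 : ℝ)).indicator (fun u ↦ cexp (-s * u)) u :=
      (integrable_indicator_iff measurableSet_Ioi).2 h
    refine h'.congr (ae_of_all _ fun u ↦ ?_)
    simp only [Set.indicator_apply, mem_Ioi]
    split_ifs <;> simp [neg_mul]
  have hL : Integrable fun u : ℝ ↦ (liouvilleSum (Real.exp u) : ℂ) * cexp (-(s * u)) := by
    have := hσ.add hind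
    refine this.congr (ae_of_all _ fun u ↦ ?_)
    simp only [Pi.add_apply]
    ring
  -- compute
  have hsplit : (fun u : ℝ ↦ ((liouvilleSum (Real.exp u) : ℂ) - if 0 < u then 1 else 0) *
      cexp (-(s * u))) = fun u ↦ (liouvilleSum (Real.exp u) : ℂ) * cexp (-(s * u)) -
        (if 0 < u then (1 : ℂ) else 0) * cexp (-(s * u)) := by
    funext u; ring
  rw [hsplit, integral_sub hL hind, laplace_liouvilleSum_exp hs]
  congr 1
  -- `∫ 𝟙_{u>0} e^{-su} du = 1/s`
  have hval : ∫ u : ℝ, (if 0 < u then (1 : ℂ) else 0) * cexp (-(s * u)) =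
      ∫ u in Ioi (0 : ℝ), cexp (-s * u) := by
    rw [← integral_indicator measurableSet_Ioi]
    refine integral_congr_ae (ae_of_all _ fun u ↦ ?_)
    simp only [Set.indicator_apply, mem_Ioi]
    split_ifs <;> simp [neg_mul]
  rw [hval, integral_exp_mul_complex_Ioi (by simpa using hs0) 0]
  have hs0' : s ≠ 0 := fun h ↦ by rw [h] at hs0; simp at hs0
  field_simp
  simp

/-! ## The limit `ε → 0⁺` on the right line -/

/-- `L(e^u)` is locally constant at `u₀ = log x₀` when `x₀ > 0` is not an integer. [folklore] -/
theorem liouvilleSum_exp_eventuallyEq {x₀ : ℝ} (hx₀ : 0 < x₀) (hnat : ∀ n : ℕ, (n : ℝ) ≠ x₀) :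
    (fun u : ℝ ↦ liouvilleSum (Real.exp u)) =ᶠ[𝓝 (Real.log x₀)] fun _ ↦ liouvilleSum x₀ := by
  set N : ℕ := ⌊x₀⌋₊ with hN
  have h1 : (N : ℝ) < x₀ := lt_of_le_of_ne (Nat.floor_le hx₀.le) (hnat N)
  have h2 : x₀ < N + 1 := Nat.lt_floor_add_one x₀
  -- the open set `{u : N < e^u < N + 1}` contains `log x₀`
  have hopen : IsOpen {u : ℝ | (N : ℝ) < Real.exp u ∧ Real.exp u < N + 1} :=
    (isOpen_lt continuous_const Real.continuous_exp).inter (isOpen_lt Real.continuous_exp continuous_const)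
  have hmem : Real.log x₀ ∈ {u : ℝ | (N : ℝ) < Real.exp u ∧ Real.exp u < N + 1} := by
    simp only [mem_setOf_eq, Real.exp_log hx₀]; exact ⟨h1, h2⟩
  filter_upwards [hopen.mem_nhds hmem] with u hu
  have hfl : ⌊Real.exp u⌋₊ = N := by
    rw [Nat.floor_eq_iff (Real.exp_pos u).le]
    exact ⟨hu.1.le, hu.2⟩
  rw [liouvilleSum_eq_liouvilleSum_floor (Real.exp u), hfl, hN, ← liouvilleSum_eq_liouvilleSum_floor]

/-- **The right line of Anderson–Stark's Theorem 1 for `L(x)`** (Lemma 1 on `Re s = 3/2`): for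
`x₀ > 1` not an integer, as `ε → 0⁺`,
`∫ Ψ_{ε,x₀}(3/2 + it) dt → 2π (L(x₀) − 1)/√x₀`, where
`Ψ_{ε,x₀}(z) = (ζ(2z)/(zζ(z)) − 1/z) e^{ε(z−½)²} e^{(z−½)log x₀}` — i.e.
`(1/2πi)∫_{(3/2)} G(s) e^{ε(s−½)²} x₀^{s−½} ds → x₀^{−1/2} g(x₀)`.
[cite: AndersonStark1981, §4 Theorem 1 (proof) and Lemma 1] -/
theorem andersonStark_rightLine_tendsto {x₀ : ℝ} (hx₀ : 1 < x₀) (hnat : ∀ n : ℕ, (n : ℝ) ≠ x₀) :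
    Tendsto (fun ε : ℝ ↦ ∫ t : ℝ,
        (riemannZeta (2 * (((3 / 2 : ℝ) : ℂ) + t * I)) /
            ((((3 / 2 : ℝ) : ℂ) + t * I) * riemannZeta (((3 / 2 : ℝ) : ℂ) + t * I)) -
          1 / (((3 / 2 : ℝ) : ℂ) + t * I)) *
        (cexp (ε * ((((3 / 2 : ℝ) : ℂ) + t * I) - 1 / 2) ^ 2) *
          cexp (((((3 / 2 : ℝ) : ℂ) + t * I) - 1 / 2) * Real.log x₀)))
      (𝓝[>] 0) (𝓝 ((2 * π : ℂ) * (((((liouvilleSum x₀ : ℝ) - 1) / Real.sqrt x₀ : ℝ)) : ℂ))) := by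
  have hx₀0 : 0 < x₀ := by linarith
  have hu₀ : 0 < Real.log x₀ := Real.log_pos hx₀
  set f : ℝ → ℂ := fun u ↦ (liouvilleSum (Real.exp u) : ℂ) - if 0 < u then 1 else 0 with hf
  have hσ : (1 : ℝ) < 3 / 2 := by norm_num
  have hint : Integrable fun u ↦ f u * (Real.exp (-(3 / 2 * u)) : ℂ) :=
    integrable_liouvilleShift_damped hσ
  -- continuity of `f e^{-σu}` at `u₀ = log x₀`
  have hcont : ContinuousAt (fun u ↦ f u * (Real.exp (-(3 / 2 * u)) : ℂ)) (Real.log x₀) := by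
    have hev : (fun u ↦ f u * (Real.exp (-(3 / 2 * u)) : ℂ)) =ᶠ[𝓝 (Real.log x₀)]
        fun u ↦ ((liouvilleSum x₀ : ℂ) - 1) * (Real.exp (-(3 / 2 * u)) : ℂ) := by
      filter_upwards [liouvilleSum_exp_eventuallyEq hx₀0 hnat, (isOpen_Ioi.mem_nhds hu₀)]
        with u hu hu0
      simp only [hf, hu, if_pos (show 0 < u from hu0)]
    refine (ContinuousAt.congr ?_ hev.symm)
    exact (continuousAt_const.mul (by fun_prop))
  have hmain := AndersonStark1981_lemma1 (σ := 3 / 2) hint hcont 1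
  -- identify the integrands
  have heq : ∀ ε : ℝ, (∫ t : ℝ,
      (riemannZeta (2 * (((3 / 2 : ℝ) : ℂ) + t * I)) /
          ((((3 / 2 : ℝ) : ℂ) + t * I) * riemannZeta (((3 / 2 : ℝ) : ℂ) + t * I)) -
        1 / (((3 / 2 : ℝ) : ℂ) + t * I)) *
      (cexp (ε * ((((3 / 2 : ℝ) : ℂ) + t * I) - 1 / 2) ^ 2) *
        cexp (((((3 / 2 : ℝ) : ℂ) + t * I) - 1 / 2) * Real.log x₀))) =
      ∫ t : ℝ, (∫ u : ℝ, f u * cexp (-((((3 / 2 : ℝ) : ℂ) + t * I) * u))) *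
        (cexp (ε * (((1 : ℝ) : ℂ) + t * I) ^ 2) * cexp ((((1 : ℝ) : ℂ) + t * I) * Real.log x₀)) := by
    intro ε
    refine integral_congr_ae (ae_of_all _ fun t ↦ ?_)
    have hs : 1 < ((((3 / 2 : ℝ) : ℂ) + t * I)).re := by simp; norm_num
    have e : (((3 / 2 : ℝ) : ℂ) + t * I) - 1 / 2 = ((1 : ℝ) : ℂ) + t * I := by push_cast; ring
    simp only [hf]
    rw [laplace_liouvilleShift_eq hs, e]
  simp_rw [heq]
  -- identify the limits
  have hlim : (2 * π : ℂ) * (Real.exp (1 * Real.log x₀) : ℂ) *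
      (f (Real.log x₀) * (Real.exp (-(3 / 2 * Real.log x₀)) : ℂ)) =
      (2 * π : ℂ) * (((((liouvilleSum x₀ : ℝ) - 1) / Real.sqrt x₀ : ℝ)) : ℂ) := by
    have hfu : f (Real.log x₀) = (liouvilleSum x₀ : ℂ) - 1 := by
      simp only [hf, Real.exp_log hx₀0, if_pos hu₀]
    rw [hfu, one_mul, Real.exp_log hx₀0]
    have hexp : Real.exp (-(3 / 2 * Real.log x₀)) = 1 / (x₀ * Real.sqrt x₀) := by
      rw [Real.exp_neg, show 3 / 2 * Real.log x₀ = Real.log x₀ + Real.log x₀ / 2 by ring,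
        Real.exp_add, Real.exp_log hx₀0, show Real.log x₀ / 2 = Real.log (Real.sqrt x₀) by
          rw [Real.log_sqrt hx₀0.le], Real.exp_log (Real.sqrt_pos.2 hx₀0)]
      rw [one_div]
    rw [hexp]
    have hx : (x₀ : ℂ) ≠ 0 := by exact_mod_cast hx₀0.ne'
    have hsq : (Real.sqrt x₀ : ℂ) ≠ 0 := by exact_mod_cast (Real.sqrt_pos.2 hx₀0).ne'
    push_cast
    field_simp
  rw [hlim] at hmain
  simp only [hf] at hmain
  exact hmain

/-- **Integrability on the right line**: for `ε > 0` (and any real `x₀`) the integrand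
`t ↦ Ψ_{ε,x₀}(3/2 + it)` is integrable on `ℝ` (`|G(3/2+it)| ≤ ∫ |f| e^{−3u/2}` is bounded, `G` is
continuous, and `|e^{ε(1+it)²}| = e^{ε(1−t²)}`). [folklore] -/
theorem andersonStark_rightLine_integrable (x₀ : ℝ) {ε : ℝ} (hε : 0 < ε) :
    Integrable fun t : ℝ ↦
      (riemannZeta (2 * (((3 / 2 : ℝ) : ℂ) + t * I)) /
          ((((3 / 2 : ℝ) : ℂ) + t * I) * riemannZeta (((3 / 2 : ℝ) : ℂ) + t * I)) -
        1 / (((3 / 2 : ℝ) : ℂ) + t * I)) *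
      (cexp (ε * ((((3 / 2 : ℝ) : ℂ) + t * I) - 1 / 2) ^ 2) *
        cexp (((((3 / 2 : ℝ) : ℂ) + t * I) - 1 / 2) * Real.log x₀)) := by
  set f : ℝ → ℂ := fun u ↦ (liouvilleSum (Real.exp u) : ℂ) - if 0 < u then 1 else 0 with hf
  have hσ : (1 : ℝ) < 3 / 2 := by norm_num
  have hint : Integrable fun u ↦ f u * (Real.exp (-(3 / 2 * u)) : ℂ) :=
    integrable_liouvilleShift_damped hσ
  set C : ℝ := ∫ u, ‖f u * (Real.exp (-(3 / 2 * u)) : ℂ)‖ with hC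
  -- the bound `‖G(3/2 + it)‖ ≤ C`
  have hG : ∀ t : ℝ, ‖riemannZeta (2 * (((3 / 2 : ℝ) : ℂ) + t * I)) /
      ((((3 / 2 : ℝ) : ℂ) + t * I) * riemannZeta (((3 / 2 : ℝ) : ℂ) + t * I)) -
      1 / (((3 / 2 : ℝ) : ℂ) + t * I)‖ ≤ C := by
    intro t
    have hs : 1 < ((((3 / 2 : ℝ) : ℂ) + t * I)).re := by simp; norm_num
    rw [← laplace_liouvilleShift_eq hs]
    refine (norm_integral_le_integral_norm _).trans (le_of_eq ?_)
    refine integral_congr_ae (ae_of_all _ fun u ↦ ?_)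
    simp only [hf]
    rw [norm_mul, norm_mul, Complex.norm_exp, Complex.norm_real, Real.norm_of_nonneg
      (Real.exp_pos _).le]
    congr 1
    congr 1
    simp
  -- continuity of the integrand
  have hcont : Continuous fun t : ℝ ↦
      (riemannZeta (2 * (((3 / 2 : ℝ) : ℂ) + t * I)) /
          ((((3 / 2 : ℝ) : ℂ) + t * I) * riemannZeta (((3 / 2 : ℝ) : ℂ) + t * I)) -
        1 / (((3 / 2 : ℝ) : ℂ) + t * I)) *
      (cexp (ε * ((((3 / 2 : ℝ) : ℂ) + t * I) - 1 / 2) ^ 2) *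
        cexp (((((3 / 2 : ℝ) : ℂ) + t * I) - 1 / 2) * Real.log x₀)) := by
    have hs : ∀ t : ℝ, (((3 / 2 : ℝ) : ℂ) + t * I) ≠ 1 := by
      intro t h; have := congrArg Complex.re h; norm_num at this
    have hs2 : ∀ t : ℝ, 2 * (((3 / 2 : ℝ) : ℂ) + t * I) ≠ 1 := by
      intro t h; have := congrArg Complex.re h; norm_num at this
    have hs0 : ∀ t : ℝ, (((3 / 2 : ℝ) : ℂ) + t * I) ≠ 0 := by
      intro t h; have := congrArg Complex.re h; norm_num at this
    have hζ : ∀ t : ℝ, riemannZeta (((3 / 2 : ℝ) : ℂ) + t * I) ≠ 0 := fun t ↦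
      riemannZeta_ne_zero_of_one_lt_re (by simp; norm_num)
    have hζc : ContinuousOn riemannZeta {1}ᶜ := fun s hs1 ↦
      (differentiableAt_riemannZeta hs1).continuousAt.continuousWithinAt
    have hline : Continuous fun t : ℝ ↦ ((3 / 2 : ℝ) : ℂ) + t * I := by fun_prop
    have hz1 : Continuous fun t : ℝ ↦ riemannZeta (((3 / 2 : ℝ) : ℂ) + t * I) :=
      hζc.comp_continuous hline fun t ↦ hs t
    have hz2 : Continuous fun t : ℝ ↦ riemannZeta (2 * (((3 / 2 : ℝ) : ℂ) + t * I)) :=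
      hζc.comp_continuous (by fun_prop : Continuous fun t : ℝ ↦ 2 * (((3 / 2 : ℝ) : ℂ) + t * I))
        fun t ↦ hs2 t
    refine Continuous.mul (Continuous.sub ?_ ?_) (by fun_prop)
    · exact hz2.div (hline.mul hz1) fun t ↦ mul_ne_zero (hs0 t) (hζ t)
    · exact continuous_const.div hline hs0
  -- the Gaussian majorant
  have hK : ∀ t : ℝ, ‖cexp (ε * ((((3 / 2 : ℝ) : ℂ) + t * I) - 1 / 2) ^ 2) *
      cexp (((((3 / 2 : ℝ) : ℂ) + t * I) - 1 / 2) * Real.log x₀)‖ =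
      Real.exp (ε * 1 ^ 2 + 1 * Real.log x₀) * Real.exp (-(ε * t ^ 2)) := by
    intro t
    have e : (((3 / 2 : ℝ) : ℂ) + t * I) - 1 / 2 = ((1 : ℝ) : ℂ) + t * I := by push_cast; ring
    rw [e]
    exact norm_gaussKernel ε 1 (Real.log x₀) t
  have hmaj : Integrable fun t : ℝ ↦ C * (Real.exp (ε * 1 ^ 2 + 1 * Real.log x₀) *
      Real.exp (-(ε * t ^ 2))) := by
    have h := (integrable_exp_neg_mul_sq hε).const_mul (C * Real.exp (ε * 1 ^ 2 + 1 * Real.log x₀))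
    refine h.congr (ae_of_all _ fun t ↦ ?_)
    simp only [neg_mul]
    ring
  refine hmaj.mono' hcont.aestronglyMeasurable (Eventually.of_forall fun t ↦ ?_)
  rw [norm_mul, hK]
  exact mul_le_mul_of_nonneg_right (hG t) (by positivity)

end Literature.NumberTheory.LFunctions
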